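import Summits.CriticalPhenomena.PercolationContinuityZ3.Theorems.FK.PressureElementaryBounds
import Summits.CriticalPhenomena.PercolationContinuityZ3.Theorems.FK.PressureMagnetizationSumRule
import Summits.CriticalPhenomena.PercolationContinuityZ3.Theorems.FK.FieldSaturation
import Literature.Probability.LatticeModels.ModifiedSimonInequality
import HarnessLib

/-!
# HIGH-TEMPERATURE AND PARAMAGNETIC LOWER BOUNDS ON THE ISING PRESSURE:
# `ψ(β,h) ≥ log 2 + d·log cosh β + log cosh(βh)` (`β ≥ 0`), from the high-temperature expansion
# `Z^∅_{Λ;β,0} = 2^{|Λ|} (cosh β)^{|E_Λ|} Σ_{∂F = ∅} (tanh β)^{|F|}` and the GKS comparison `tanh(βh) ≤ m(β,h)`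
# (Friedli–Velenik 2017, §3.7.3, Exercise 3.12, eq. (3.9); Duminil-Copin, *Lectures on the Ising and Potts models* §2.2.1)

Claimed R42 (8)(c) in the cell INBOX at 2026-08-29T06:10:52Z by fkp-10a gen 358 (NEW CLAIM #6 of the gen), addressed to coordinator fk-4 gen 292 (seated 04:05Z 2026-08-29 by l.8710; R166 – R170 in force); lineage row FO-10a-g358h (self-suggested), package g358-hightemp, label HT-A.
Helper file of the `fk-continuity` build cell (bschramm lane; `--supports stmt-CriticalPhenomena-4575`); builds on
p205010 (kernel theorem, internal audit signed; external expert review pending). No definitions, no named facts, no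
sorries; standard axioms. UNCONDITIONAL (nearest-neighbour Ising model on `ℤ^d`; the tree's parametrisation
`exp(β Σ_e σ_e + βh Σ_x σ_x)`).

The two-sided bounds of `PressureElementaryBounds` (`β(d + |h|) ≤ ψ(β,h) ≤ |β|d + log(2 cosh βh)`) are sharp at LOW
temperature; this file supplies the bounds that are sharp at HIGH temperature (exact for `d = 1` at `h = 0`, and exact
to second order in `β` for every `d`):

Finite volume (any locally finite graph `G`, volume `Λ`, free boundary condition, zero field, `β ≥ 0`):
* `one_le_hteSum_empty` — the high-temperature generating sum `g_Λ(∅) = Σ_{F ⊆ E_Λ, ∂F = ∅} t^{|F|} ≥ 1` (`t ≥ 0`; the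
  empty even subgraph);
* **`two_pow_mul_cosh_pow_le_isingPartitionFunction_free`** — `2^{|Λ|} (cosh β)^{|E_Λ|} ≤ Z^∅_{Λ;β,0}`, and its
  logarithm `card_mul_log_two_add_mul_log_cosh_le` — `|Λ| log 2 + |E_Λ| log cosh β ≤ log Z^∅_{Λ;β,0}`.

Infinite volume on `ℤ^d` (`ψ(β,h) = pressure d β h`, box limit `hasBoxLimit_pressureIn_holds`, `|E_{Λ_N}|/|Λ_N| → d`):
* **`log_two_add_mul_log_cosh_le_pressure`** — `log 2 + d log cosh β ≤ ψ(β,0)` (`β ≥ 0`); with the elementary upper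
  bound: `pressure_zero_field_mem_Icc` — `ψ(β,0) ∈ [log 2 + d log cosh β, log 2 + βd]`;
* **`log_cosh_mul_le_pressure_sub_pressure_zero`** — THE PARAMAGNETIC COMPARISON `log cosh(βh) ≤ ψ(β,h) − ψ(β,0)`
  (`d ≥ 1`, `β ≥ 0`, every real `h`): the sum rule `∂ψ/∂h = β m(β,h)` (`hasDerivAt_pressure_field`) and the GKS bound
  `tanh(βh) ≤ m(β,h)` (`tanh_mul_le_magnetizationInField`) make `h ↦ ψ(β,h) − log cosh(βh)` nondecreasing on
  `[0,∞)` (`monotoneOn_pressure_sub_log_cosh`); evenness in `h` does the rest;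
* **`log_two_add_mul_log_cosh_add_log_cosh_le_pressure`** — `log 2 + d log cosh β + log cosh(βh) ≤ ψ(β,h)`: the
  pressure dominates that of `d` independent bonds plus an independent paramagnet per site;
  `mul_add_log_cosh_mul_le_pressure` — `βd + log cosh(βh) ≤ ψ(β,h)` (paramagnetic comparison on top of the ground-state
  bound `βd ≤ ψ(β,0)`).

## References

* S. Friedli, Y. Velenik, *Statistical Mechanics of Lattice Systems*, CUP (2017), §3.7.3 (high-temperature
  expansion), Exercise 3.12 (`⟨σ_0⟩ ≥ tanh h` by GKS), §3.2.3 eq. (3.9), Thm. 3.6, Exercise 3.3. [FriedliVelenik2017]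
* H. Duminil-Copin, *Lectures on the Ising and Potts models on the hypercubic lattice* (2017/18), §2.2.1
  (high-temperature expansion `Z = 2^{|Λ|} cosh(β)^{|E|} Σ_{∂E = ∅} tanh(β)^{|E|}`). [DuminilCopinECM2018]
* R. B. Griffiths, *Correlations in Ising ferromagnets. II*, J. Math. Phys. 8 (1967) 484–489 (GKS comparison with
  decoupled systems). [Griffiths1967]
-/

noncomputable section

namespace Summit.CriticalPhenomena.PercolationContinuityZ3.Theorems.FK

namespace IsingPressure

open MeasureTheory Filter Topology Finset Set
open Literature.Probability.LatticeModels IsingSusceptibility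

variable {d : ℕ}

/-! ### Finite volume: the high-temperature expansion bounds `Z^∅_{Λ;β,0}` from below -/

section FiniteVolume

variable {V : Type*} [DecidableEq V] (G : SimpleGraph V) [G.LocallyFinite]

/-- `g_Λ(∅) = Σ_{F ⊆ E_Λ, ∂F = ∅} t^{|F|} ≥ 1` for `t ≥ 0`: the empty edge set is an even subgraph and every term is
nonnegative. [cite: DuminilCopinECM2018, §2.2.1 (high-temperature expansion)] -/
theorem one_le_hteSum_empty (Λ : Finset V) {t : ℝ} (ht : 0 ≤ t) : 1 ≤ hteSum G Λ t ∅ := by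
  rw [hteSum]
  have hmem : (∅ : Finset (Sym2 V)) ∈ (edgesIn G Λ).powerset.filter (fun F => oddVerts Λ F = ∅) :=
    mem_filter.2 ⟨empty_mem_powerset _, oddVerts_empty Λ⟩
  calc (1 : ℝ) = t ^ #(∅ : Finset (Sym2 V)) := by rw [Finset.card_empty, pow_zero]
    _ ≤ _ := single_le_sum (f := fun F : Finset (Sym2 V) => t ^ #F) (fun F _ => pow_nonneg ht _) hmem

/-- **`2^{|Λ|} (cosh β)^{|E_Λ|} ≤ Z^∅_{Λ;β,0}`** for `β ≥ 0` (any locally finite graph): keep only the empty even subgraph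
in the high-temperature expansion `Z^∅_{Λ;β,0} = 2^{|Λ|} cosh(β)^{|E_Λ|} g_Λ(∅)`
(`isingPartitionFunction_free_eq_hteSum`). [cite: DuminilCopinECM2018, §2.2.1 (high-temperature expansion)]
[cite: FriedliVelenik2017, §3.7.3] -/
theorem two_pow_mul_cosh_pow_le_isingPartitionFunction_free (Λ : Finset V) {β : ℝ} (hβ : 0 ≤ β) :
    (2 : ℝ) ^ #Λ * Real.cosh β ^ #(edgesIn G Λ) ≤ isingPartitionFunction G Λ β 0 .free := by
  have ht : 0 ≤ Real.tanh β := by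
    rw [Real.tanh_eq_sinh_div_cosh]
    exact div_nonneg (Real.sinh_nonneg_iff.2 hβ) (Real.cosh_pos β).le
  rw [isingPartitionFunction_free_eq_hteSum G Λ β, card_spinConfig_coe]
  push_cast
  exact le_mul_of_one_le_right (by positivity) (one_le_hteSum_empty G Λ ht)

/-- **`|Λ| log 2 + |E_Λ| log cosh β ≤ log Z^∅_{Λ;β,0}`** for `β ≥ 0` (any locally finite graph).
[cite: DuminilCopinECM2018, §2.2.1 (high-temperature expansion)] [cite: FriedliVelenik2017, §3.7.3] -/
theorem card_mul_log_two_add_mul_log_cosh_le (Λ : Finset V) {β : ℝ} (hβ : 0 ≤ β) :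
    #Λ * Real.log 2 + #(edgesIn G Λ) * Real.log (Real.cosh β) ≤
      Real.log (isingPartitionFunction G Λ β 0 .free) := by
  have hpos : (0 : ℝ) < (2 : ℝ) ^ #Λ * Real.cosh β ^ #(edgesIn G Λ) := by positivity
  calc #Λ * Real.log 2 + #(edgesIn G Λ) * Real.log (Real.cosh β)
      = Real.log ((2 : ℝ) ^ #Λ * Real.cosh β ^ #(edgesIn G Λ)) := by
        rw [Real.log_mul (by positivity) (by positivity), Real.log_pow, Real.log_pow]
    _ ≤ _ := Real.log_le_log hpos (two_pow_mul_cosh_pow_le_isingPartitionFunction_free G Λ hβ)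

end FiniteVolume

/-! ### Infinite volume: `log 2 + d log cosh β ≤ ψ(β,0)` -/

/-- **HIGH-TEMPERATURE LOWER BOUND `log 2 + d·log cosh β ≤ ψ(β,0)`** for `β ≥ 0` (every `d`): divide
`|Λ_N| log 2 + |E_{Λ_N}| log cosh β ≤ log Z^∅_{Λ_N;β,0}` by `|Λ_N|` and use `|E_{Λ_N}|/|Λ_N| → d`. Exact for `d = 1`;
exact to order `β²` for every `d` (`ψ(β,0) = log 2 + d log cosh β + O(tanh⁴β)`).
[cite: FriedliVelenik2017, §3.7.3] [cite: DuminilCopinECM2018, §2.2.1 (high-temperature expansion)] -/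
theorem log_two_add_mul_log_cosh_le_pressure {β : ℝ} (hβ : 0 ≤ β) :
    Real.log 2 + d * Real.log (Real.cosh β) ≤ pressure d β 0 := by
  have hlim : Tendsto (fun L : ℕ => pressureIn (zdGraph d) (box d L) β 0 .free) atTop (𝓝 (pressure d β 0)) :=
    hasBoxLimit_pressureIn_holds (d := d) β 0 .free
  set c : ℝ := Real.log (Real.cosh β) with hc
  have hlow : Tendsto (fun L : ℕ => Real.log 2 + c * (((edgesIn (zdGraph d) (box d L)).card : ℝ) / (box d L).card))
      atTop (𝓝 (Real.log 2 + c * d)) :=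
    tendsto_const_nhds.add ((tendsto_card_edgesIn_box_div_card_box (d := d)).const_mul c)
  rw [mul_comm (d : ℝ) c]
  refine le_of_tendsto_of_tendsto' hlow hlim fun L => ?_
  have hpos : (0 : ℝ) < #(box d L) := by exact_mod_cast (box_nonempty d L).card_pos
  rw [pressureIn, le_div_iff₀ hpos]
  have := card_mul_log_two_add_mul_log_cosh_le (zdGraph d) (box d L) hβ
  calc (Real.log 2 + c * (((edgesIn (zdGraph d) (box d L)).card : ℝ) / (box d L).card)) * #(box d L)
      = #(box d L) * Real.log 2 + #(edgesIn (zdGraph d) (box d L)) * c := by field_simp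
    _ ≤ _ := this

/-- **`ψ(β,0) ∈ [log 2 + d log cosh β, log 2 + βd]`** for `β ≥ 0`: the high-temperature lower bound together with the
elementary upper bound `ψ(β,h) ≤ |β|d + log(2 cosh βh)` at `h = 0` (`pressure_le_add_log_cosh`). The width
`d(β − log cosh β) ≤ d log 2` of the window is `dβ²/2 + O(β⁴)` as `β → 0`.
[cite: FriedliVelenik2017, §3.7.3, Thm. 3.6 (proof)] -/
theorem pressure_zero_field_mem_Icc {β : ℝ} (hβ : 0 ≤ β) :
    pressure d β 0 ∈ Icc (Real.log 2 + d * Real.log (Real.cosh β)) (Real.log 2 + β * d) := by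
  refine ⟨log_two_add_mul_log_cosh_le_pressure hβ, ?_⟩
  have h1 := pressure_le_add_log_cosh (d := d) β 0
  rw [mul_zero, Real.cosh_zero, mul_one, abs_of_nonneg hβ] at h1
  linarith

/-! ### The paramagnetic comparison `log cosh(βh) ≤ ψ(β,h) − ψ(β,0)` -/

/-- `d/dt log cosh(βt) = β tanh(βt)`. [folklore] -/
theorem hasDerivAt_log_cosh_mul (β t : ℝ) :
    HasDerivAt (fun s => Real.log (Real.cosh (β * s))) (β * Real.tanh (β * t)) t := by
  have h1 : HasDerivAt (fun s => β * s) β t := by simpa using (hasDerivAt_id t).const_mul β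
  have h2 : HasDerivAt (fun s => Real.log (Real.cosh (β * s))) (Real.sinh (β * t) * β / Real.cosh (β * t)) t :=
    h1.cosh.log (Real.cosh_pos _).ne'
  convert h2 using 1
  rw [Real.tanh_eq_sinh_div_cosh, ← mul_div_assoc, mul_comm β]

/-- **`h ↦ ψ(β,h) − log cosh(βh)` is nondecreasing on `[0,∞)`** (`d ≥ 1`, `β ≥ 0`): its derivative at `h > 0` is
`β (m(β,h) − tanh(βh)) ≥ 0` by the sum rule `∂ψ/∂h = β m(β,h)` and the GKS comparison with a single site
`tanh(βh) ≤ m(β,h)`. [cite: FriedliVelenik2017, Exercise 3.12 and eq. (3.9)] [cite: Griffiths1967, Thm. 1 ff.] -/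
theorem monotoneOn_pressure_sub_log_cosh (hd : 1 ≤ d) {β : ℝ} (hβ : 0 ≤ β) :
    MonotoneOn (fun h => pressure d β h - Real.log (Real.cosh (β * h))) (Ici 0) := by
  have hcont : Continuous fun h => pressure d β h - Real.log (Real.cosh (β * h)) :=
    (continuous_pressure_field (d := d) β).sub
      ((Real.continuous_cosh.comp (continuous_const_mul β)).log fun h => (Real.cosh_pos _).ne')
  have hder : ∀ h : ℝ, 0 < h → HasDerivAt (fun h => pressure d β h - Real.log (Real.cosh (β * h)))
      (β * magnetizationInField d β h - β * Real.tanh (β * h)) h := fun h hh =>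
    (hasDerivAt_pressure_field hd hβ hh).sub (hasDerivAt_log_cosh_mul β h)
  refine monotoneOn_of_deriv_nonneg (convex_Ici 0) hcont.continuousOn
    (fun h hh => (hder h (by rwa [interior_Ici] at hh)).differentiableAt.differentiableWithinAt) fun h hh => ?_
  rw [interior_Ici] at hh
  rw [(hder h hh).deriv, ← mul_sub]
  refine mul_nonneg hβ (sub_nonneg.2 ?_)
  rcases hβ.eq_or_lt with rfl | hβ'
  · -- `β = 0`: `tanh 0 = 0 ≤ m(0,h) = ⟨σ_0⟩⁺_{0,h}` (GKS I)
    rw [zero_mul, Real.tanh_zero, magnetizationInField_eq_plusCorr]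
    exact plusCorr_nonneg (d := d) le_rfl (le_of_lt hh) _
  · exact tanh_mul_le_magnetizationInField hβ' (le_of_lt hh)

/-- **THE PARAMAGNETIC COMPARISON `log cosh(βh) ≤ ψ(β,h) − ψ(β,0)`** (`d ≥ 1`, `β ≥ 0`, every real `h`): the free
energy released by the field is at least that of independent spins (`ψ_param(β,h) − ψ_param(β,0) = log cosh(βh)`);
equivalently `Z(β,h)/Z(β,0) = ⟨e^{βh Σσ}⟩_{β,0} ≳ (cosh βh)^{|Λ|}`. From `monotoneOn_pressure_sub_log_cosh` between `0`
and `|h|`, and the evenness `ψ(β,−h) = ψ(β,h)`. [cite: FriedliVelenik2017, Exercise 3.12 and eq. (3.9)]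
[cite: Griffiths1967, Thm. 1 ff.] -/
theorem log_cosh_mul_le_pressure_sub_pressure_zero (hd : 1 ≤ d) {β : ℝ} (hβ : 0 ≤ β) (h : ℝ) :
    Real.log (Real.cosh (β * h)) ≤ pressure d β h - pressure d β 0 := by
  -- nonnegative fields first
  have key : ∀ h : ℝ, 0 ≤ h → Real.log (Real.cosh (β * h)) ≤ pressure d β h - pressure d β 0 := by
    intro h hh
    have hmono := monotoneOn_pressure_sub_log_cosh hd hβ (mem_Ici.2 le_rfl) (mem_Ici.2 hh) hh
    simp only [mul_zero, Real.cosh_zero, Real.log_one, sub_zero] at hmono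
    linarith
  rcases le_total 0 h with hh | hh
  · exact key h hh
  · have h1 := key (-h) (neg_nonneg.2 hh)
    rwa [pressure_neg_field, mul_neg, Real.cosh_neg] at h1

/-- **`log 2 + d·log cosh β + log cosh(βh) ≤ ψ(β,h)`** (`d ≥ 1`, `β ≥ 0`, every real `h`): the Ising pressure dominates
the pressure of `d` independent bonds per site plus an independent paramagnet — the high-temperature bound at `h = 0`
plus the paramagnetic comparison. Sharp to second order in `(β, βh)` near the infinite-temperature point.
[cite: FriedliVelenik2017, §3.7.3, Exercise 3.12] [cite: DuminilCopinECM2018, §2.2.1 (high-temperature expansion)] -/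
theorem log_two_add_mul_log_cosh_add_log_cosh_le_pressure (hd : 1 ≤ d) {β : ℝ} (hβ : 0 ≤ β) (h : ℝ) :
    Real.log 2 + d * Real.log (Real.cosh β) + Real.log (Real.cosh (β * h)) ≤ pressure d β h := by
  linarith [log_two_add_mul_log_cosh_le_pressure (d := d) hβ, log_cosh_mul_le_pressure_sub_pressure_zero hd hβ h]

/-- **`βd + log cosh(βh) ≤ ψ(β,h)`** (`d ≥ 1`, `β ≥ 0`): the paramagnetic comparison on top of the ground-state bound
`βd ≤ ψ(β,0)` (`mul_add_abs_le_pressure` at `h = 0`) — better than `log 2 + d log cosh β + log cosh(βh)` at low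
temperature, and within `log 2` of the elementary bound `β(d + |h|)` (`log cosh x ≥ |x| − log 2`).
[cite: FriedliVelenik2017, Thm. 3.6 (proof), Exercise 3.3, Exercise 3.12] -/
theorem mul_add_log_cosh_mul_le_pressure (hd : 1 ≤ d) {β : ℝ} (hβ : 0 ≤ β) (h : ℝ) :
    β * d + Real.log (Real.cosh (β * h)) ≤ pressure d β h := by
  have h1 := mul_add_abs_le_pressure (d := d) β 0
  rw [abs_zero, add_zero] at h1
  linarith [log_cosh_mul_le_pressure_sub_pressure_zero hd hβ h]

/-- **The three lower bounds combined**: `max (β(d + |h|)) (max (log 2 + d log cosh β) (βd) + log cosh(βh)) ≤ ψ(β,h)`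
(`d ≥ 1`, `β ≥ 0`). [cite: FriedliVelenik2017, Thm. 3.6 (proof), Exercise 3.3, Exercise 3.12, §3.7.3] -/
theorem max_le_pressure (hd : 1 ≤ d) {β : ℝ} (hβ : 0 ≤ β) (h : ℝ) :
    max (β * (d + |h|)) (max (Real.log 2 + d * Real.log (Real.cosh β)) (β * d) + Real.log (Real.cosh (β * h))) ≤
      pressure d β h := by
  refine max_le (mul_add_abs_le_pressure β h) ?_
  rcases le_total (Real.log 2 + d * Real.log (Real.cosh β)) (β * d) with hle | hle
  · rw [max_eq_right hle]; exact mul_add_log_cosh_mul_le_pressure hd hβ h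
  · rw [max_eq_left hle]; exact log_two_add_mul_log_cosh_add_log_cosh_le_pressure hd hβ h

end IsingPressure

end Summit.CriticalPhenomena.PercolationContinuityZ3.Theorems.FK
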